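import Summits.ABC.IUTFork.Repair.RHReqsideWeightLawsSegmentKappaFiveHalves
import HarnessLib

/-!
# D-0122 AXIS B, knob k1 — THE TYPED FORM, part 3k: the SHIFTED law `a = 1` IS DOWNWARD CLOSED — a law-independent
# consecutive-label coupling `e ∣ m + (j+2)(1+s) + (j+1)u`, and the seg dichotomy of parts 3h–3j closed with no open cell

abc-iut cell, rung LADDER-ABC:A2.RESCUE.H; seat abc-iut-reqb-typ-1 (GEN 4; D-0122 axis B typer k1/k4; R69 (A1) hardening queue); owner abc-iut-rh-lead g4
(`plan/rescue/R-H/ROUND3/REQB-SPEC.md` v0.2 §1 k1 shifted law `lawShift a j = (j+a)² − (1+a)² + 1`, `a ∈ {1, 2}`; §3 column «seg violations»: 0 on the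
bed for row S-k1-shift1 — an ENGINE fact about 1,531 tabulated places). Parts 3h/3i/3j = p524026 `Repair/RHReqsideWeightLawsSegment.lean` (closure for
laws with `Δf·j ≥ 2(f(j) − 1)`; tame-type witnesses against `κ = 1`, `κ = 3/2`) / p524917 `…SegmentShift.lean` (witness against shift `a = 2`) / p525613
`…SegmentKappaFiveHalves.lean` (`κ = 5/2` closed), which left exactly ONE cell open: shift `a = 1` (`f(j) = (j+1)² − 3`; part 3h's increment condition
`(2j+3)·j ≥ 2(j² + 2j − 3)` holds only for `j ≤ 6`; no violation in ≈ 2·10⁶ searched configurations). This file PROVES that cell. Nothing re-typed.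
* §1 `coupling_of_not_cell_of_cell_succ` — **LAW-INDEPENDENT COUPLING OF CONSECUTIVE LABELS** (`den = 1`, `e > 0`, `m ≥ 0`, any `f`): if label `j`
  FAILS and label `j+1` HOLDS, then with `x = A_j mod e`, `y = A_{j+1} mod e` (`A_j = f(j)m − jδ − (j+1)r_in`), the failing slack `s ≥ 0`
  (`e⌊A_j/e⌋ = B_j + 1 + s`, `B_j = m − (j+1)r_out`) and the holding slack `u ≥ 0` (`e⌊A_{j+1}/e⌋ = B_{j+1} − u`): the linear demands are
  `L_j = x + 1 + s`, `L_{j+1} = y − u` (`L_j = (f(j)−1)m − jδ − (j+1)G`, `G = r_in − r_out`) AND **`e ∣ N := m + (j+2)(1+s) + (j+1)u`** — because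
  `(j+2)B_j − (j+1)B_{j+1} = m` identically, so `N = e·((j+2)⌊A_j/e⌋ − (j+1)⌊A_{j+1}/e⌋)`; as `N ≥ j + 2 > 0`, **`e ≤ N`**, i.e. `y ≤ e − 1 ≤ N − 1`.
  (Reading: a sporadic licensed label above a failing one needs ramification `e ≤ m_q + (j+2)(1+s) + (j+1)u` — depth plus label-weighted slacks.)
* §2 `not_cell_shiftOne_succ_of_not_cell` — **SHIFT `a = 1` IS DOWNWARD CLOSED** under the local-field hypotheses (`0 < e`, `e − 1 ≤ δ`, `r_out ≤ r_in`,
  `0 ≤ m`, `j ≥ 1`): `¬ Cell_j ⟹ ¬ Cell_{j+1}`. Proof: for this law `f(j) − 1 = (j+3)(j−1)`, `f(j+1) − 1 = j(j+4)`, and eliminating `m` between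
  `L_j`, `L_{j+1}` gives the identity `(j+3)(j−1)·L_{j+1} = j(j+4)·L_j + (j²+j+3)δ + (j²+3j+6)G`. Bounding `y ≤ δ` (from `y ≤ e − 1 ≤ δ`) yields
  (I) `(j−6)δ ≥ j(j+4)(x+1+s) + (j²+3j+6)G + (j+3)(j−1)u` (already absurd for `j ≤ 6` — part 3h's regime); bounding `y ≤ N − 1` (§1) and substituting
  `(j+3)(j−1)m = jδ + (j+1)G + x + 1 + s` yields (II) `(j²+3)δ ≤ (1+s)(j³+3j²−3j−5) − (j²+4j−1)x − (j²+2j+5)G + (j³+2j²−3j)u − (j²+2j−3)`; and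
  `(j²+3)·(I) + (j−6)·(II)` for `j ≥ 7` leaves `(7j³+24j²−j−30)(1+s) + (6j³+15j²−12j−9)u + (…)x + (…)G + (j−6)(j²+2j−3) ≤ 0` with every coefficient
  positive — absurd since `1 + s ≥ 1`. Corollaries `cell_shiftOne_of_succ`, `cell_shiftOne_anti`, `not_cell_shiftOne_mono`, the boundary form
  `cell_shiftOne_iff_le_of_boundary`, existence of the cutoff `exists_boundary_shiftOne` («seg = 1» and `j₀(w)` a TRUE CUTOFF for row S-k1-shift1 and its
  pairs, at every place a local field can present), and the tier-L0 threshold in closed form from the cutoff alone: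
  `six_mul_offDemand_shiftOne_of_boundary`: `6·T_shift1 = L(L−1)(2L+11) − J(J−1)(2J+11)` (part 3a `offDemand_eq_of_boundary` + part 1's sum).
* §3 WORKED PLACE FREY `p = 7`, `l = 107` (`e 1605`, `m 210`, `δ 1604`, `r_in 268`, `r_out −4472`, `l⋆ = 53`): part 1's boundary pair `worked_shift`
  (`29` IN, `30` OUT) now determines the whole column, so `T_shift1 = (53·52·117 − 29·28·69)/6 = 44404` label units — part 3b's worked value, here
  obtained from TWO cell evaluations instead of 53 (`worked_offDemand_shiftOne`).
SEG DICHOTOMY (parts 3h–3k), now without an open cell: downward closure PROVED for print, shift `a = 1`, `κ = 5/2`, `κ = 3`, affine `c ≥ 1`; REFUTED as a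
law property (tame-type integer witnesses) for `κ = 1`, `κ = 3/2`, shift `a = 2`. For the PROVED rows «seg = 1» is a theorem at every place; for the
REFUTED rows it is a property of the tabulated bed only (engines: 0 violations on 1,531 places; computed ≠ proved).
HONEST FRAMING: integer arithmetic about OUR typed cell with a free pilot law (a PARAMETER — REQB-SPEC FRAMING); nothing here asserts that abc is proved or
refuted, or that [IUTchIII] Cor. 3.12 / [IUTchIV] Thm. 1.10 holds or fails at any datum, or takes a side on any author; typed ≠ proved; computed ≠ proved.
[claim: Mochizuki2012, status: disputed] for every IUT locution. [cite: Mochizuki2012, IUTchIV Prop. 1.2 (i)(ii) p. 10, Prop. 1.4 p. 13]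
[cite: SerreLocalFields1979, Ch. III §6 Prop. 13]
-/

namespace Summit.ABC.IUTFork.Repair.RH.ReqsideWeightLaws

/-! ## §1. The law-independent coupling of a failing label with a holding successor -/

/-- **CONSECUTIVE-LABEL COUPLING** (any law `f`, `den = 1`, `e > 0`, `m ≥ 0`): if `¬ Cell_j` and `Cell_{j+1}` then there are `x, y ∈ [0, e−1]` (the
residues of the two floor arguments) and slacks `s, u ≥ 0` with `(f(j)−1)m − (jδ + (j+1)G) = x + 1 + s`, `(f(j+1)−1)m − ((j+1)δ + (j+2)G) = y − u`
(`G = r_in − r_out`), `e ∣ m + (j+2)(1+s) + (j+1)u` and hence `e ≤ m + (j+2)(1+s) + (j+1)u`. [folklore] -/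
theorem coupling_of_not_cell_of_cell_succ {f : ℕ → ℤ} {e m δ rin rout : ℤ} (he : 0 < e) (hm : 0 ≤ m) {j : ℕ}
    (h : ¬ Cell f 1 e m δ rin rout j) (h' : Cell f 1 e m δ rin rout (j + 1)) :
    ∃ x y s u : ℤ, 0 ≤ x ∧ x ≤ e - 1 ∧ 0 ≤ y ∧ y ≤ e - 1 ∧ 0 ≤ s ∧ 0 ≤ u ∧
      (f j - 1) * m - ((j : ℤ) * δ + ((j : ℤ) + 1) * (rin - rout)) = x + 1 + s ∧
      (f (j + 1) - 1) * m - (((j : ℤ) + 1) * δ + ((j : ℤ) + 2) * (rin - rout)) = y - u ∧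
      e ∣ m + ((j : ℤ) + 2) * (1 + s) + ((j : ℤ) + 1) * u ∧
      e ≤ m + ((j : ℤ) + 2) * (1 + s) + ((j : ℤ) + 1) * u := by
  unfold Cell at h h'
  push Not at h
  simp only [one_mul, Nat.cast_add, Nat.cast_one] at h h'
  set A : ℤ := f j * m - ((j : ℤ) * δ + ((j : ℤ) + 1) * rin) with hA
  set A' : ℤ := f (j + 1) * m - (((j : ℤ) + 1) * δ + ((j : ℤ) + 1 + 1) * rin) with hA'
  have hxA : e * (A / e) + A % e = A := Int.mul_ediv_add_emod A e
  have hyA : e * (A' / e) + A' % e = A' := Int.mul_ediv_add_emod A' e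
  have hx1 : A % e < e := Int.emod_lt_of_pos A he
  have hy1 : A' % e < e := Int.emod_lt_of_pos A' he
  -- the divisibility: `(j+2)B_j − (j+1)B_{j+1} = m`
  have hdvd : e ∣ m + ((j : ℤ) + 2) * (1 + (e * (A / e) - (m - ((j : ℤ) + 1) * rout) - 1)) +
      ((j : ℤ) + 1) * ((m - ((j : ℤ) + 1 + 1) * rout) - e * (A' / e)) :=
    ⟨((j : ℤ) + 2) * (A / e) - ((j : ℤ) + 1) * (A' / e), by ring⟩
  have hle : e ≤ m + ((j : ℤ) + 2) * (1 + (e * (A / e) - (m - ((j : ℤ) + 1) * rout) - 1)) +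
      ((j : ℤ) + 1) * ((m - ((j : ℤ) + 1 + 1) * rout) - e * (A' / e)) := by
    obtain ⟨K, hK⟩ := hdvd
    have hpos : 0 < e * K := by
      rw [← hK]
      have hj0 : (0 : ℤ) ≤ (j : ℤ) := Nat.cast_nonneg j
      nlinarith
    have hK1 : 1 ≤ K := by
      by_contra hlt
      push Not at hlt
      nlinarith
    rw [hK]
    nlinarith
  refine ⟨A % e, A' % e, e * (A / e) - (m - ((j : ℤ) + 1) * rout) - 1, (m - ((j : ℤ) + 1 + 1) * rout) - e * (A' / e),
    Int.emod_nonneg _ he.ne', by linarith, Int.emod_nonneg _ he.ne', by linarith, by linarith, by linarith, ?_, ?_, hdvd, hle⟩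
  · linear_combination (-1 : ℤ) * hxA
  · linear_combination (-1 : ℤ) * hyA

/-! ## §2. Shift `a = 1` is downward closed -/

/-- The shifted law `a = 1` at consecutive labels: `lawShift 1 j − 1 = (j+3)(j−1)` and `lawShift 1 (j+1) − 1 = j(j+4)`. [folklore] -/
theorem lawShift_one_sub_one (j : ℕ) :
    lawShift 1 j - 1 = ((j : ℤ) + 3) * ((j : ℤ) - 1) ∧ lawShift 1 (j + 1) - 1 = (j : ℤ) * ((j : ℤ) + 4) := by
  unfold lawShift
  push_cast
  constructor <;> ring

/-- **SHIFT `a = 1`: FAILURE PROPAGATES UPWARD** (`0 < e`, `e − 1 ≤ δ`, `r_out ≤ r_in`, `0 ≤ m`, `j ≥ 1`): `¬ Cell (lawShift 1) 1 … j ⟹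
¬ Cell (lawShift 1) 1 … (j+1)` — by the coupling of §1 and the identity `(j+3)(j−1)·L_{j+1} = j(j+4)·L_j + (j²+j+3)δ + (j²+3j+6)G` (module docstring,
inequalities (I), (II)). The one cell part 3h's increment criterion could not reach. [folklore] -/
theorem not_cell_shiftOne_succ_of_not_cell {e m δ rin rout : ℤ} (he : 0 < e) (hδ : e - 1 ≤ δ) (hio : rout ≤ rin) (hm : 0 ≤ m)
    {j : ℕ} (hj : 1 ≤ j) (h : ¬ Cell (lawShift 1) 1 e m δ rin rout j) : ¬ Cell (lawShift 1) 1 e m δ rin rout (j + 1) := by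
  intro h'
  obtain ⟨x, y, s, u, hx0, -, -, hye, hs, hu, hL, hL', -, hN⟩ := coupling_of_not_cell_of_cell_succ he hm h h'
  obtain ⟨hf, hf'⟩ := lawShift_one_sub_one j
  rw [hf] at hL
  rw [hf'] at hL'
  set G : ℤ := rin - rout with hG
  have hG0 : 0 ≤ G := by rw [hG]; linarith
  have hjz : (1 : ℤ) ≤ (j : ℤ) := by exact_mod_cast hj
  have hyδ : y ≤ δ := by linarith
  have hc : (0 : ℤ) ≤ ((j : ℤ) + 3) * ((j : ℤ) - 1) := mul_nonneg (by linarith) (by linarith)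
  -- the identity (ID), eliminating `m`
  have hID : ((j : ℤ) + 3) * ((j : ℤ) - 1) * (y - u) =
      (j : ℤ) * ((j : ℤ) + 4) * (x + 1 + s) + ((j : ℤ) ^ 2 + j + 3) * δ + ((j : ℤ) ^ 2 + 3 * j + 6) * G := by
    rw [← hL, ← hL']
    ring
  -- (I): from `y ≤ δ`
  have hI : (j : ℤ) * ((j : ℤ) + 4) * (x + 1 + s) + ((j : ℤ) ^ 2 + 3 * j + 6) * G + ((j : ℤ) + 3) * ((j : ℤ) - 1) * u ≤
      ((j : ℤ) - 6) * δ := by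
    have h1 := mul_le_mul_of_nonneg_left hyδ hc
    linarith [hID, h1]
  -- (II): from `y ≤ N − 1` and `(j+3)(j−1)m = jδ + (j+1)G + x + 1 + s`
  have hII : ((j : ℤ) ^ 2 + 3) * δ ≤ (1 + s) * ((j : ℤ) ^ 3 + 3 * j ^ 2 - 3 * j - 5) - ((j : ℤ) ^ 2 + 4 * j - 1) * x
      - ((j : ℤ) ^ 2 + 2 * j + 5) * G + ((j : ℤ) ^ 3 + 2 * j ^ 2 - 3 * j) * u - ((j : ℤ) ^ 2 + 2 * j - 3) := by
    have hyN : y ≤ m + ((j : ℤ) + 2) * (1 + s) + ((j : ℤ) + 1) * u - 1 := by linarith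
    have h1 := mul_le_mul_of_nonneg_left hyN hc
    linarith [hID, h1, hL]
  -- positivity of the pieces
  have hxs : 1 ≤ x + 1 + s := by linarith
  have hP1 : 0 < (j : ℤ) * ((j : ℤ) + 4) * (x + 1 + s) := by
    have : 0 < (j : ℤ) * ((j : ℤ) + 4) := mul_pos (by linarith) (by linarith)
    nlinarith
  have hP2 : 0 ≤ ((j : ℤ) ^ 2 + 3 * j + 6) * G := mul_nonneg (by positivity) hG0
  have hP3 : 0 ≤ ((j : ℤ) + 3) * ((j : ℤ) - 1) * u := mul_nonneg hc hu
  by_cases hj6 : (j : ℤ) ≤ 6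
  · -- part 3h's regime: (I) alone is absurd
    have hδ0 : 0 ≤ δ := by linarith
    have h6 : ((j : ℤ) - 6) * δ ≤ 0 := mul_nonpos_of_nonpos_of_nonneg (by linarith) hδ0
    linarith
  · push Not at hj6
    have hj7 : (7 : ℤ) ≤ (j : ℤ) := by omega
    have hsq : 7 * (j : ℤ) ≤ (j : ℤ) ^ 2 := by nlinarith
    have hcb : 49 * (j : ℤ) ≤ (j : ℤ) ^ 3 := by nlinarith
    have hA := mul_le_mul_of_nonneg_left hI (by positivity : (0 : ℤ) ≤ (j : ℤ) ^ 2 + 3)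
    have hB := mul_le_mul_of_nonneg_left hII (by linarith : (0 : ℤ) ≤ (j : ℤ) - 6)
    have q1 : 0 < (7 * (j : ℤ) ^ 3 + 24 * j ^ 2 - j - 30) * (1 + s) :=
      mul_pos (by linarith) (by linarith)
    have q2 : 0 ≤ (6 * (j : ℤ) ^ 3 + 15 * j ^ 2 - 12 * j - 9) * u := mul_nonneg (by linarith) hu
    have q3 : 0 ≤ (((j : ℤ) ^ 2 + 3) * j * (j + 4) + (j - 6) * (j ^ 2 + 4 * j - 1)) * x :=
      mul_nonneg (add_nonneg (by positivity) (mul_nonneg (by linarith) (by linarith))) hx0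
    have q4 : 0 ≤ (((j : ℤ) ^ 2 + 3) * (j ^ 2 + 3 * j + 6) + (j - 6) * (j ^ 2 + 2 * j + 5)) * G :=
      mul_nonneg (add_nonneg (by positivity) (mul_nonneg (by linarith) (by positivity))) hG0
    have q5 : 0 ≤ ((j : ℤ) - 6) * (j ^ 2 + 2 * j - 3) := mul_nonneg (by linarith) (by linarith)
    linarith [hA, hB, q1, q2, q3, q4, q5]

/-- **SHIFT `a = 1` IS DOWNWARD CLOSED**: `Cell (lawShift 1) 1 … (j+1) ⟹ Cell (lawShift 1) 1 … j` (`j ≥ 1`, local-field hypotheses). «seg = 1» is a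
THEOREM for row S-k1-shift1 and its pairs. [folklore] -/
theorem cell_shiftOne_of_succ {e m δ rin rout : ℤ} (he : 0 < e) (hδ : e - 1 ≤ δ) (hio : rout ≤ rin) (hm : 0 ≤ m) {j : ℕ} (hj : 1 ≤ j)
    (h : Cell (lawShift 1) 1 e m δ rin rout (j + 1)) : Cell (lawShift 1) 1 e m δ rin rout j := by
  by_contra h'
  exact not_cell_shiftOne_succ_of_not_cell he hδ hio hm hj h' h

/-- … iterated: `1 ≤ j ≤ j'`, `Cell_{j'} ⟹ Cell_j` under shift `a = 1`. [folklore] -/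
theorem cell_shiftOne_anti {e m δ rin rout : ℤ} (he : 0 < e) (hδ : e - 1 ≤ δ) (hio : rout ≤ rin) (hm : 0 ≤ m) {j j' : ℕ}
    (hj : 1 ≤ j) (hjj : j ≤ j') (h : Cell (lawShift 1) 1 e m δ rin rout j') : Cell (lawShift 1) 1 e m δ rin rout j := by
  induction hjj with
  | refl => exact h
  | step hle ih => exact ih (cell_shiftOne_of_succ he hδ hio hm (le_trans hj hle) h)

/-- … and failure is monotone in the label under shift `a = 1`: `¬ Cell_j ⟹ ¬ Cell_{j'}` for `1 ≤ j ≤ j'`. [folklore] -/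
theorem not_cell_shiftOne_mono {e m δ rin rout : ℤ} (he : 0 < e) (hδ : e - 1 ≤ δ) (hio : rout ≤ rin) (hm : 0 ≤ m) {j j' : ℕ}
    (hj : 1 ≤ j) (hjj : j ≤ j') (h : ¬ Cell (lawShift 1) 1 e m δ rin rout j) : ¬ Cell (lawShift 1) 1 e m δ rin rout j' :=
  fun h' => h (cell_shiftOne_anti he hδ hio hm hj hjj h')

/-- **ONE BOUNDARY PAIR PINS THE COLUMN** under shift `a = 1`: `Cell_J`, `¬ Cell_{J+1}` (`J ≥ 1`) give `Cell_j ⟺ j ≤ J` for every `j ≥ 1`. [folklore] -/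
theorem cell_shiftOne_iff_le_of_boundary {e m δ rin rout : ℤ} (he : 0 < e) (hδ : e - 1 ≤ δ) (hio : rout ≤ rin) (hm : 0 ≤ m) {J : ℕ}
    (hJ : 1 ≤ J) (hin : Cell (lawShift 1) 1 e m δ rin rout J) (hoff : ¬ Cell (lawShift 1) 1 e m δ rin rout (J + 1)) {j : ℕ}
    (hj : 1 ≤ j) : Cell (lawShift 1) 1 e m δ rin rout j ↔ j ≤ J := by
  constructor
  · intro h
    by_contra hlt
    exact not_cell_shiftOne_mono he hδ hio hm (by omega) (by omega : J + 1 ≤ j) hoff h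
  · intro h
    exact cell_shiftOne_anti he hδ hio hm hj h hin

/-- **THE CUTOFF EXISTS** under shift `a = 1`: for every `L` there is `J ≤ L` with `Cell_j ⟺ j ≤ J` on `1 ≤ j ≤ L` (label `1` is IN by part 1's
`cell_at_one`, `lawShift_at_one`; induction on `L`). So `j₀(w)` is a true cutoff for this law at every place a local field can present. [folklore] -/
theorem exists_boundary_shiftOne {e m δ rin rout : ℤ} (he : 0 < e) (hδ : e - 1 ≤ δ) (hio : rout ≤ rin) (hm : 0 ≤ m) (L : ℕ) :
    ∃ J : ℕ, J ≤ L ∧ ∀ j : ℕ, 1 ≤ j → j ≤ L → (Cell (lawShift 1) 1 e m δ rin rout j ↔ j ≤ J) := by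
  induction L with
  | zero => exact ⟨0, le_rfl, fun j hj hjL => by omega⟩
  | succ n ih =>
    obtain ⟨J, hJL, hJ⟩ := ih
    by_cases htop : Cell (lawShift 1) 1 e m δ rin rout (n + 1)
    · refine ⟨n + 1, le_rfl, fun j hj hjL => ⟨fun _ => hjL, fun hle => cell_shiftOne_anti he hδ hio hm hj hle htop⟩⟩
    · refine ⟨J, Nat.le_succ_of_le hJL, fun j hj hjL => ?_⟩
      rcases Nat.lt_or_ge j (n + 1) with hlt | hge
      · exact hJ j hj (by omega)
      · have hjn : j = n + 1 := by omega
        subst hjn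
        exact ⟨fun hc => absurd hc htop, fun hle => by exfalso; omega⟩

/-- **THE TIER-L0 THRESHOLD FROM THE CUTOFF ALONE** under shift `a = 1`: with a boundary pair at `J ≥ 1` (`Cell_J`, `¬ Cell_{J+1}`) and `J ≤ L`,
`6·offDemand (lawShift 1) 1 … L = L(L−1)(2L+11) − J(J−1)(2J+11)` — part 3a's `offDemand_eq_of_boundary` (its segment hypothesis now DISCHARGED by
closure) and part 1's `six_mul_demandSum_shift`. [folklore] -/
theorem six_mul_offDemand_shiftOne_of_boundary {e m δ rin rout : ℤ} (he : 0 < e) (hδ : e - 1 ≤ δ) (hio : rout ≤ rin) (hm : 0 ≤ m)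
    {J L : ℕ} (hJ : 1 ≤ J) (hJL : J ≤ L) (hin : Cell (lawShift 1) 1 e m δ rin rout J) (hoff : ¬ Cell (lawShift 1) 1 e m δ rin rout (J + 1)) :
    6 * offDemand (lawShift 1) 1 e m δ rin rout L = (L : ℤ) * (L - 1) * (2 * L + 11) - (J : ℤ) * (J - 1) * (2 * J + 11) := by
  rw [offDemand_eq_of_boundary hJL (fun j hj _ => cell_shiftOne_iff_le_of_boundary he hδ hio hm hJ hin hoff hj), mul_sub,
    six_mul_demandSum_shift, six_mul_demandSum_shift]
  push_cast
  ring

/-! ## §3. Worked place FREY `p = 7`, `l = 107`: the shift-1 column from two cell evaluations -/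

/-- At the worked place (`e 1605`, `m 210`, `δ 1604`, `r_in 268`, `r_out −4472`, `l⋆ = 53`) part 1's boundary pair `worked_shift` (label `29` IN,
`30` OUT) pins the shift-1 column: `Cell_j ⟺ j ≤ 29` for every `j ≥ 1`. [folklore] -/
theorem worked_cell_shiftOne_iff {j : ℕ} (hj : 1 ≤ j) : Cell (lawShift 1) 1 1605 210 1604 268 (-4472) j ↔ j ≤ 29 :=
  cell_shiftOne_iff_le_of_boundary (by norm_num) (by norm_num) (by norm_num) (by norm_num) (by norm_num) worked_shift.1.1 worked_shift.1.2 hj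

/-- … hence `T_shift1 = (53·52·117 − 29·28·69)/6 = 44404` label units on `{1, …, 53}` — part 3b's worked value, from the cutoff alone. [folklore] -/
theorem worked_offDemand_shiftOne : offDemand (lawShift 1) 1 1605 210 1604 268 (-4472) 53 = 44404 := by
  have h := six_mul_offDemand_shiftOne_of_boundary (by norm_num) (by norm_num) (by norm_num) (by norm_num) (by norm_num)
    (by norm_num : 29 ≤ 53) worked_shift.1.1 worked_shift.1.2
  push_cast at h
  linarith

end Summit.ABC.IUTFork.Repair.RH.ReqsideWeightLaws
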